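import Literature.Computability.AlgebraicComplexity.BorderRankMatMulThreeTransportData
import Literature.Computability.AlgebraicComplexity.BorderApolarityRelabel
import HarnessLib

/-!
# Borel-fixed candidates of `⟨3,3,3⟩`: the `(011)` and `(101)` members in `(110)` coordinates

Topic `Literature/Computability/AlgebraicComplexity`. The three members `E₁ ≤ A ⊗ B`,
`E₂ ≤ B ⊗ C`, `E₃ ≤ A ⊗ C` of a Borel-fixed candidate triple of `⟨3,3,3⟩`
(`MatMul3.exists_borelFixed_triple`) play symmetric roles under the cyclic symmetry of the matrix
multiplication tensor. Pulling `E₂`, `E₃` back along the relabelings `MatMul3.σ₂`, `MatMul3.σ₃`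
of `BorderRankMatMulThreeTransportData.lean` gives subspaces of `K^{A ⊗ B}` with the block
structure of `BorderRankMatMulThreeBlocks.lean`, on which the root moves act by `ad X_{pq}`,
`shiftV`, `shiftW`:

* `MatMul3.isAdmissible_map_σ₂`, `MatMul3.isAdmissible_map_σ₃` — the pulled-back members are
  admissible (`MatMul3.IsAdmissible`);
* `MatMul3.exists_admissible_triple` — **a degeneration of `⟨3,3,3⟩` with `16` triads yields a
  candidate triple all of whose members are admissible in `(110)` coordinates and pass the
  `(210)`/`(120)` tests there** (test dimensions transported by `BorderApolarityRelabel.lean`).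

## References

* A. Conner, A. Harper, J. M. Landsberg, *New lower bounds for matrix multiplication and `det₃`*,
  Forum Math. Pi 11 (2023) e17, arXiv:1911.07981 — §2.5, §6. [ConnerHarperLandsberg2023]
-/

noncomputable section

open scoped BigOperators Kronecker Polynomial

open Matrix Polynomial

namespace Literature.Computability.AlgebraicComplexity

namespace BorderApolarity

namespace MatMul3

open TensorApolarity

universe u


/-! ## Over a field -/

section Field

variable (K : Type u) [Field K]

/-- A Kronecker move evaluated along a bijective relabeling `σ`: `(M ⊗ N) y (σ c) = ∑_{c'} … y (σ c')`.
[folklore] -/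
theorem kron_apply_relabel {σ : I9 × I9 → I9 × I9} (hσ : Function.Bijective σ)
    (MZ NZ : Matrix I9 I9 ℤ) (y : I9 × I9 → K) (c : I9 × I9) :
    ((MZ.map (Int.castRingHom K) ⊗ₖ NZ.map (Int.castRingHom K)) *ᵥ y) (σ c) =
      ∑ c' : I9 × I9, ((MZ (σ c).1 (σ c').1 * NZ (σ c).2 (σ c').2 : ℤ) : K) * y (σ c') := by
  rw [kronecker_mulVec_apply, ← Fintype.sum_prod_type']
  rw [← hσ.sum_comp fun p : I9 × I9 =>
    (MZ.map (Int.castRingHom K)) (σ c).1 p.1 * (NZ.map (Int.castRingHom K)) (σ c).2 p.2 * y (p.1, p.2)]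
  refine Finset.sum_congr rfl fun c' _ => ?_
  simp only [Matrix.map_apply, eq_intCast, Int.cast_mul, Prod.mk.eta]

/-- A sum against `δ_{c c'}` picks out `x c`. [folklore] -/
theorem sum_ite_eq_mul (x : I9 × I9 → K) (c : I9 × I9) :
    ∑ c' : I9 × I9, ((if c = c' then (1 : ℤ) else 0 : ℤ) : K) * x c' = x c := by
  rw [Finset.sum_eq_single c]
  · simp
  · intro c' _ hne; simp [Ne.symm hne]
  · intro h; exact absurd (Finset.mem_univ _) h

/-- `Qm ⊗ Rm` along `σ₂`. [folklore] -/
theorem kron₂_apply (g ρ : Fin 3) (y : I9 × I9 → K) (c : I9 × I9) :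
    ((Qm K (g, ρ) ⊗ₖ Rm K (g, ρ)) *ᵥ y) (σ₂ c) = ∑ c' : I9 × I9, (TZ₂ g ρ c c' : K) * y (σ₂ c') := by
  rw [Qm, Rm, kron_apply_relabel K σ₂_bijective]
  rfl

/-- `Qm' ⊗ Rm'` along `σ₂`. [folklore] -/
theorem kron₂'_apply (g ρ : Fin 3) (y : I9 × I9 → K) (c : I9 × I9) :
    ((Qm' K (g, ρ) ⊗ₖ Rm' K (g, ρ)) *ᵥ y) (σ₂ c) = ∑ c' : I9 × I9, (TZ₂' g ρ c c' : K) * y (σ₂ c') := by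
  rw [Qm', Rm', kron_apply_relabel K σ₂_bijective]
  rfl

/-- `Pm ⊗ Rm` along `σ₃`. [folklore] -/
theorem kron₃_apply (g ρ : Fin 3) (z : I9 × I9 → K) (c : I9 × I9) :
    ((Pm K (g, ρ) ⊗ₖ Rm K (g, ρ)) *ᵥ z) (σ₃ c) = ∑ c' : I9 × I9, (TZ₃ g ρ c c' : K) * z (σ₃ c') := by
  rw [Pm, Rm, kron_apply_relabel K σ₃_bijective]
  rfl

/-- `Pm' ⊗ Rm'` along `σ₃`. [folklore] -/
theorem kron₃'_apply (g ρ : Fin 3) (z : I9 × I9 → K) (c : I9 × I9) :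
    ((Pm' K (g, ρ) ⊗ₖ Rm' K (g, ρ)) *ᵥ z) (σ₃ c) = ∑ c' : I9 × I9, (TZ₃' g ρ c c' : K) * z (σ₃ c') := by
  rw [Pm', Rm', kron_apply_relabel K σ₃_bijective]
  rfl

/-- **`V`-moves of `E₂` in `(110)` coordinates: `u y - u⁻¹ y = 2 ad X_{pq} (y ∘ σ₂)`.**
[cite: ConnerHarperLandsberg2023, §2.5] -/
theorem kron₂_V_sub (ρ : Fin 3) (y : I9 × I9 → K) :
    ((Qm K (1, ρ) ⊗ₖ Rm K (1, ρ)) *ᵥ y) ∘ σ₂ - ((Qm' K (1, ρ) ⊗ₖ Rm' K (1, ρ)) *ᵥ y) ∘ σ₂ =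
      (2 : K) • adU (rootPQ ρ).1 (rootPQ ρ).2 (y ∘ σ₂) := by
  funext c
  rw [Pi.sub_apply, Pi.smul_apply, Function.comp_apply, Function.comp_apply, kron₂_apply,
    kron₂'_apply, adU_apply_sum, smul_eq_mul, Finset.mul_sum, ← Finset.sum_sub_distrib]
  refine Finset.sum_congr rfl fun c' _ => ?_
  have h := congrArg (Int.cast : ℤ → K) (TZ₂_V ρ c c')
  simp only [Int.cast_sub, Int.cast_mul, Int.cast_ofNat] at h
  rw [Function.comp_apply, ← sub_mul, h]
  ring

/-- **`W`-moves of `E₂` in `(110)` coordinates: `u y - y = -shiftV_{rev q, rev p} (y ∘ σ₂)`.**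
[cite: ConnerHarperLandsberg2023, §2.5] -/
theorem kron₂_W_sub (ρ : Fin 3) (y : I9 × I9 → K) :
    ((Qm K (2, ρ) ⊗ₖ Rm K (2, ρ)) *ᵥ y) ∘ σ₂ - y ∘ σ₂ =
      -shiftV (rootPQ ρ).2.rev (rootPQ ρ).1.rev (y ∘ σ₂) := by
  funext c
  have hx : y (σ₂ c) = ∑ c' : I9 × I9, ((if c = c' then (1 : ℤ) else 0 : ℤ) : K) * (y ∘ σ₂) c' :=
    (sum_ite_eq_mul K (y ∘ σ₂) c).symm
  rw [Pi.sub_apply, Pi.neg_apply, Function.comp_apply, Function.comp_apply, kron₂_apply,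
    shiftV_apply_sum, hx, ← Finset.sum_sub_distrib, ← Finset.sum_neg_distrib]
  refine Finset.sum_congr rfl fun c' _ => ?_
  have h := congrArg (Int.cast : ℤ → K) (TZ₂_W ρ c c')
  simp only [Int.cast_sub, Int.cast_neg] at h
  rw [Function.comp_apply, ← sub_mul, h, neg_mul]

/-- **`U`-moves of `E₂` in `(110)` coordinates: `u y - y = -shiftW_{rev q, rev p} (y ∘ σ₂)`.**
[cite: ConnerHarperLandsberg2023, §2.5] -/
theorem kron₂_U_sub (ρ : Fin 3) (y : I9 × I9 → K) :
    ((Qm K (0, ρ) ⊗ₖ Rm K (0, ρ)) *ᵥ y) ∘ σ₂ - y ∘ σ₂ =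
      -shiftW (rootPQ ρ).2.rev (rootPQ ρ).1.rev (y ∘ σ₂) := by
  funext c
  have hx : y (σ₂ c) = ∑ c' : I9 × I9, ((if c = c' then (1 : ℤ) else 0 : ℤ) : K) * (y ∘ σ₂) c' :=
    (sum_ite_eq_mul K (y ∘ σ₂) c).symm
  rw [Pi.sub_apply, Pi.neg_apply, Function.comp_apply, Function.comp_apply, kron₂_apply,
    shiftW_apply_sum, hx, ← Finset.sum_sub_distrib, ← Finset.sum_neg_distrib]
  refine Finset.sum_congr rfl fun c' _ => ?_
  have h := congrArg (Int.cast : ℤ → K) (TZ₂_U ρ c c')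
  simp only [Int.cast_sub, Int.cast_neg] at h
  rw [Function.comp_apply, ← sub_mul, h, neg_mul]

/-- **`W`-moves of `E₃` in `(110)` coordinates: `u z - u⁻¹ z = 2 ad X_{pq} (z ∘ σ₃)`.**
[cite: ConnerHarperLandsberg2023, §2.5] -/
theorem kron₃_W_sub (ρ : Fin 3) (z : I9 × I9 → K) :
    ((Pm K (2, ρ) ⊗ₖ Rm K (2, ρ)) *ᵥ z) ∘ σ₃ - ((Pm' K (2, ρ) ⊗ₖ Rm' K (2, ρ)) *ᵥ z) ∘ σ₃ =
      (2 : K) • adU (rootPQ ρ).1 (rootPQ ρ).2 (z ∘ σ₃) := by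
  funext c
  rw [Pi.sub_apply, Pi.smul_apply, Function.comp_apply, Function.comp_apply, kron₃_apply,
    kron₃'_apply, adU_apply_sum, smul_eq_mul, Finset.mul_sum, ← Finset.sum_sub_distrib]
  refine Finset.sum_congr rfl fun c' _ => ?_
  have h := congrArg (Int.cast : ℤ → K) (TZ₃_W ρ c c')
  simp only [Int.cast_sub, Int.cast_mul, Int.cast_ofNat] at h
  rw [Function.comp_apply, ← sub_mul, h]
  ring

/-- **`V`-moves of `E₃` in `(110)` coordinates: `u z - z = -shiftV_{rev q, rev p} (z ∘ σ₃)`.**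
[cite: ConnerHarperLandsberg2023, §2.5] -/
theorem kron₃_V_sub (ρ : Fin 3) (z : I9 × I9 → K) :
    ((Pm K (1, ρ) ⊗ₖ Rm K (1, ρ)) *ᵥ z) ∘ σ₃ - z ∘ σ₃ =
      -shiftV (rootPQ ρ).2.rev (rootPQ ρ).1.rev (z ∘ σ₃) := by
  funext c
  have hx : z (σ₃ c) = ∑ c' : I9 × I9, ((if c = c' then (1 : ℤ) else 0 : ℤ) : K) * (z ∘ σ₃) c' :=
    (sum_ite_eq_mul K (z ∘ σ₃) c).symm
  rw [Pi.sub_apply, Pi.neg_apply, Function.comp_apply, Function.comp_apply, kron₃_apply,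
    shiftV_apply_sum, hx, ← Finset.sum_sub_distrib, ← Finset.sum_neg_distrib]
  refine Finset.sum_congr rfl fun c' _ => ?_
  have h := congrArg (Int.cast : ℤ → K) (TZ₃_V ρ c c')
  simp only [Int.cast_sub, Int.cast_neg] at h
  rw [Function.comp_apply, ← sub_mul, h, neg_mul]

/-- **`U`-moves of `E₃` in `(110)` coordinates: `u z - z = shiftW_{pq} (z ∘ σ₃)`.**
[cite: ConnerHarperLandsberg2023, §2.5] -/
theorem kron₃_U_sub (ρ : Fin 3) (z : I9 × I9 → K) :
    ((Pm K (0, ρ) ⊗ₖ Rm K (0, ρ)) *ᵥ z) ∘ σ₃ - z ∘ σ₃ =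
      shiftW (rootPQ ρ).1 (rootPQ ρ).2 (z ∘ σ₃) := by
  funext c
  have hx : z (σ₃ c) = ∑ c' : I9 × I9, ((if c = c' then (1 : ℤ) else 0 : ℤ) : K) * (z ∘ σ₃) c' :=
    (sum_ite_eq_mul K (z ∘ σ₃) c).symm
  rw [Pi.sub_apply, Function.comp_apply, Function.comp_apply, kron₃_apply, shiftW_apply_sum, hx,
    ← Finset.sum_sub_distrib]
  refine Finset.sum_congr rfl fun c' _ => ?_
  have h := congrArg (Int.cast : ℤ → K) (TZ₃_U ρ c c')
  simp only [Int.cast_sub] at h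
  rw [Function.comp_apply, ← sub_mul, h]

/-! ## Admissibility of the transported members -/

variable {K}

/-- `funLeft σ y = y ∘ σ`. [folklore] -/
theorem funLeft_eq_comp (σ : I9 × I9 → I9 × I9) (y : I9 × I9 → K) :
    LinearMap.funLeft K K σ y = y ∘ σ := rfl

/-- Root and diagonal components of a relabeled graded subspace, from weight separation.
[cite: ConnerHarperLandsberg2023, §2.5] -/
theorem unit_diag_mem_of_isGraded {σ : I9 × I9 → I9 × I9} {eX eY : I9 → ℕ}
    (hroot : ∀ c c' : I9 × I9, c.1.1 ≠ c.2.1 → wt₁ eX eY (σ c') = wt₁ eX eY (σ c) → c' = c)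
    (hdiag : ∀ (c : I9 × I9) (j k : Fin 3), wt₁ eX eY (σ c) = wt₁ eX eY (σ (blk j k 0 0)) ↔
      (c.1.2 = k ∧ c.2.2 = j ∧ c.1.1 = c.2.1))
    {E : Submodule K (I9 × I9 → K)} (hgr : WtInit.IsGraded (degIK eX eY) E) :
    (∀ j k i i', i ≠ i' → ∀ x ∈ E.map (LinearMap.funLeft K K σ),
        (Pi.single (blk j k i i') (x (blk j k i i')) : _ → K) ∈ E.map (LinearMap.funLeft K K σ)) ∧
      ∀ j k, ∀ x ∈ E.map (LinearMap.funLeft K K σ), diagProj j k x ∈ E.map (LinearMap.funLeft K K σ) := by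
  constructor
  · rintro j k i i' hii' _ ⟨y, hy, rfl⟩
    refine ⟨projDeg (degIK eX eY) (degIK eX eY (σ (blk j k i i'))) y, hgr _ y hy, ?_⟩
    funext c'
    rw [LinearMap.funLeft_apply, projDeg_apply, LinearMap.funLeft_apply, Pi.single_apply]
    by_cases hc : c' = blk j k i i'
    · rw [if_pos hc, if_pos (by rw [hc]), hc]
    · rw [if_neg hc, if_neg]
      intro heq
      apply hc
      refine hroot (blk j k i i') c' hii' ?_
      simp only [degIK] at heq
      exact_mod_cast heq
  · rintro j k _ ⟨y, hy, rfl⟩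
    refine ⟨projDeg (degIK eX eY) (degIK eX eY (σ (blk j k 0 0))) y, hgr _ y hy, ?_⟩
    funext c'
    simp only [diagProj, LinearMap.coe_mk, AddHom.coe_mk, projDeg_apply, LinearMap.funLeft_apply]
    have hiff := hdiag c' j k
    have hiff' : degIK eX eY (σ c') = degIK eX eY (σ (blk j k 0 0)) ↔
        (c'.1.2 = k ∧ c'.2.2 = j ∧ c'.1.1 = c'.2.1) := by
      rw [← hiff]; simp only [degIK]; exact_mod_cast Iff.rfl
    by_cases hc : c'.1.2 = k ∧ c'.2.2 = j ∧ c'.1.1 = c'.2.1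
    · rw [if_pos hc, if_pos (hiff'.2 hc)]
    · rw [if_neg hc, if_neg (fun h' => hc (hiff'.1 h'))]

/-- **The `(011)` member in `(110)` coordinates is admissible.** For a graded `E ≤ K^{B ⊗ C}`
containing the slices `t(a,·,·)`, fixed by the nine moves `Qm ⊗ Rm`, of dimension `≤ 16`
(characteristic `0`). [cite: ConnerHarperLandsberg2023, §2.5 and §6] -/
theorem isAdmissible_map_σ₂ [CharZero K] {E : Submodule K (I9 × I9 → K)}
    (hgr : WtInit.IsGraded (degIK eB eC) E)
    (hsl : ∀ a : I9, (fun bc : I9 × I9 => matMulTensor K 3 3 3 a bc.1 bc.2) ∈ E)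
    (hfix : ∀ gρ : Fin 3 × Fin 3, E.map (Qm K gρ ⊗ₖ Rm K gρ).mulVecLin = E)
    (hdim : Module.finrank K E ≤ 16) : IsAdmissible (E.map (LinearMap.funLeft K K σ₂)) := by
  have hmem : ∀ (gρ : Fin 3 × Fin 3) {y}, y ∈ E → (Qm K gρ ⊗ₖ Rm K gρ) *ᵥ y ∈ E := by
    intro gρ y hy
    have : (Qm K gρ ⊗ₖ Rm K gρ).mulVecLin y ∈ E.map (Qm K gρ ⊗ₖ Rm K gρ).mulVecLin :=
      Submodule.mem_map_of_mem hy
    rwa [hfix] at this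
  obtain ⟨hunit, hdiag⟩ := unit_diag_mem_of_isGraded (K := K) wt₂_root_inj wt₂_diag_iff hgr
  refine ⟨hunit, hdiag, fun j k => ?_, ?_, ?_, ?_, (Submodule.finrank_map_le _ _).trans hdim⟩
  · -- the identity of block `(j,k)` is the slice `t((rev k, rev j),·,·)`
    refine ⟨_, hsl (k.rev, j.rev), ?_⟩
    funext c
    rw [LinearMap.funLeft_apply, ← blk_eta c, diagVec_blk]
    simp only [matMulTensor, blk, σ₂, Prod.map, f₂, g₂, Fin.rev_inj]
    grind
  · rintro p q hpq _ ⟨y, hy, rfl⟩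
    obtain ⟨ρ, hρ⟩ := exists_rootPQ p q hpq
    have h1 := hmem (1, ρ) hy
    have h2 := inv_mem_of_map_eq (Qm'_mul_Qm K (1, ρ)) (Rm'_mul_Rm K (1, ρ)) (hfix (1, ρ)) hy
    have h3 := Submodule.smul_mem _ (2 : K)⁻¹ (Submodule.sub_mem _ h1 h2)
    refine ⟨_, h3, ?_⟩
    rw [map_smul, funLeft_eq_comp, funLeft_eq_comp,
      show (((Qm K (1, ρ) ⊗ₖ Rm K (1, ρ)) *ᵥ y - (Qm' K (1, ρ) ⊗ₖ Rm' K (1, ρ)) *ᵥ y) ∘ σ₂) =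
        ((Qm K (1, ρ) ⊗ₖ Rm K (1, ρ)) *ᵥ y) ∘ σ₂ - ((Qm' K (1, ρ) ⊗ₖ Rm' K (1, ρ)) *ᵥ y) ∘ σ₂
        from rfl, kron₂_V_sub, hρ, smul_smul, inv_mul_cancel₀ two_ne_zero, one_smul]
  · rintro p q hpq _ ⟨y, hy, rfl⟩
    obtain ⟨ρ, hρ⟩ := exists_rootPQ_rev p q hpq
    have h := Submodule.neg_mem _ (Submodule.sub_mem _ (hmem (2, ρ) hy) hy)
    refine ⟨_, h, ?_⟩
    rw [map_neg, funLeft_eq_comp, funLeft_eq_comp,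
      show (((Qm K (2, ρ) ⊗ₖ Rm K (2, ρ)) *ᵥ y - y) ∘ σ₂) =
        ((Qm K (2, ρ) ⊗ₖ Rm K (2, ρ)) *ᵥ y) ∘ σ₂ - y ∘ σ₂ from rfl, kron₂_W_sub, neg_neg]
    simp only [Prod.mk.injEq] at hρ
    rw [hρ.1, hρ.2]
  · rintro p q hpq _ ⟨y, hy, rfl⟩
    obtain ⟨ρ, hρ⟩ := exists_rootPQ_rev p q hpq
    have h := Submodule.neg_mem _ (Submodule.sub_mem _ (hmem (0, ρ) hy) hy)
    refine ⟨_, h, ?_⟩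
    rw [map_neg, funLeft_eq_comp, funLeft_eq_comp,
      show (((Qm K (0, ρ) ⊗ₖ Rm K (0, ρ)) *ᵥ y - y) ∘ σ₂) =
        ((Qm K (0, ρ) ⊗ₖ Rm K (0, ρ)) *ᵥ y) ∘ σ₂ - y ∘ σ₂ from rfl, kron₂_U_sub, neg_neg]
    simp only [Prod.mk.injEq] at hρ
    rw [hρ.1, hρ.2]

/-- **The `(101)` member in `(110)` coordinates is admissible.** For a graded `E ≤ K^{A ⊗ C}`
containing the slices `t(·,b,·)`, fixed by the nine moves `Pm ⊗ Rm`, of dimension `≤ 16`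
(characteristic `0`). [cite: ConnerHarperLandsberg2023, §2.5 and §6] -/
theorem isAdmissible_map_σ₃ [CharZero K] {E : Submodule K (I9 × I9 → K)}
    (hgr : WtInit.IsGraded (degIK eA eC) E)
    (hsl : ∀ b : I9, (fun ac : I9 × I9 => matMulTensor K 3 3 3 ac.1 b ac.2) ∈ E)
    (hfix : ∀ gρ : Fin 3 × Fin 3, E.map (Pm K gρ ⊗ₖ Rm K gρ).mulVecLin = E)
    (hdim : Module.finrank K E ≤ 16) : IsAdmissible (E.map (LinearMap.funLeft K K σ₃)) := by
  have hmem : ∀ (gρ : Fin 3 × Fin 3) {z}, z ∈ E → (Pm K gρ ⊗ₖ Rm K gρ) *ᵥ z ∈ E := by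
    intro gρ z hz
    have : (Pm K gρ ⊗ₖ Rm K gρ).mulVecLin z ∈ E.map (Pm K gρ ⊗ₖ Rm K gρ).mulVecLin :=
      Submodule.mem_map_of_mem hz
    rwa [hfix] at this
  obtain ⟨hunit, hdiag⟩ := unit_diag_mem_of_isGraded (K := K) wt₃_root_inj wt₃_diag_iff hgr
  refine ⟨hunit, hdiag, fun j k => ?_, ?_, ?_, ?_, (Submodule.finrank_map_le _ _).trans hdim⟩
  · -- the identity of block `(j,k)` is the slice `t(·,(k, rev j),·)`
    refine ⟨_, hsl (k, j.rev), ?_⟩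
    funext c
    rw [LinearMap.funLeft_apply, ← blk_eta c, diagVec_blk]
    simp only [matMulTensor, blk, σ₃, Prod.map, f₃, g₃, Fin.rev_inj]
    grind
  · rintro p q hpq _ ⟨z, hz, rfl⟩
    obtain ⟨ρ, hρ⟩ := exists_rootPQ p q hpq
    have h1 := hmem (2, ρ) hz
    have h2 := inv_mem_of_map_eq (Pm'_mul_Pm K (2, ρ)) (Rm'_mul_Rm K (2, ρ)) (hfix (2, ρ)) hz
    have h3 := Submodule.smul_mem _ (2 : K)⁻¹ (Submodule.sub_mem _ h1 h2)
    refine ⟨_, h3, ?_⟩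
    rw [map_smul, funLeft_eq_comp, funLeft_eq_comp,
      show (((Pm K (2, ρ) ⊗ₖ Rm K (2, ρ)) *ᵥ z - (Pm' K (2, ρ) ⊗ₖ Rm' K (2, ρ)) *ᵥ z) ∘ σ₃) =
        ((Pm K (2, ρ) ⊗ₖ Rm K (2, ρ)) *ᵥ z) ∘ σ₃ - ((Pm' K (2, ρ) ⊗ₖ Rm' K (2, ρ)) *ᵥ z) ∘ σ₃
        from rfl, kron₃_W_sub, hρ, smul_smul, inv_mul_cancel₀ two_ne_zero, one_smul]
  · rintro p q hpq _ ⟨z, hz, rfl⟩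
    obtain ⟨ρ, hρ⟩ := exists_rootPQ_rev p q hpq
    have h := Submodule.neg_mem _ (Submodule.sub_mem _ (hmem (1, ρ) hz) hz)
    refine ⟨_, h, ?_⟩
    rw [map_neg, funLeft_eq_comp, funLeft_eq_comp,
      show (((Pm K (1, ρ) ⊗ₖ Rm K (1, ρ)) *ᵥ z - z) ∘ σ₃) =
        ((Pm K (1, ρ) ⊗ₖ Rm K (1, ρ)) *ᵥ z) ∘ σ₃ - z ∘ σ₃ from rfl, kron₃_V_sub, neg_neg]
    simp only [Prod.mk.injEq] at hρ
    rw [hρ.1, hρ.2]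
  · rintro p q hpq _ ⟨z, hz, rfl⟩
    obtain ⟨ρ, hρ⟩ := exists_rootPQ p q hpq
    have h := Submodule.sub_mem _ (hmem (0, ρ) hz) hz
    refine ⟨_, h, ?_⟩
    rw [funLeft_eq_comp, funLeft_eq_comp,
      show (((Pm K (0, ρ) ⊗ₖ Rm K (0, ρ)) *ᵥ z - z) ∘ σ₃) =
        ((Pm K (0, ρ) ⊗ₖ Rm K (0, ρ)) *ᵥ z) ∘ σ₃ - z ∘ σ₃ from rfl, kron₃_U_sub, hρ]

/-! ## The admissible triple -/

/-- **A degeneration of `⟨3,3,3⟩` with `16` triads yields a candidate triple whose three members,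
in `(110)` coordinates, are admissible and pass the `(210)`/`(120)` tests.**
[cite: ConnerHarperLandsberg2023, §6] -/
theorem exists_admissible_triple (K : Type u) [Field K] [CharZero K] {h : ℕ}
    {u v w : Fin 16 → I9 → K[X]} (hd : IsApproxDecomposition h (matMulTensor K 3 3 3) u v w) :
    ∃ (E₁ E₂ E₃ : Submodule K (I9 × I9 → K)), IsCandidateTriple 16 (matMulTensor K 3 3 3) E₁ E₂ E₃ ∧
      IsAdmissible E₁ ∧ IsAdmissible (E₂.map (LinearMap.funLeft K K σ₂)) ∧
      IsAdmissible (E₃.map (LinearMap.funLeft K K σ₃)) ∧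
      16 ≤ Module.finrank K (testI (E₂.map (LinearMap.funLeft K K σ₂))) ∧
      16 ≤ Module.finrank K (testK (E₂.map (LinearMap.funLeft K K σ₂))) ∧
      16 ≤ Module.finrank K (testI (E₃.map (LinearMap.funLeft K K σ₃))) ∧
      16 ≤ Module.finrank K (testK (E₃.map (LinearMap.funLeft K K σ₃))) := by
  obtain ⟨E₁, E₂, E₃, hc, hE₁, hg₂, hg₃, hfix⟩ := exists_admissible₁ K hd
  refine ⟨E₁, E₂, E₃, hc, hE₁,
    isAdmissible_map_σ₂ hg₂ hc.slice₂ (fun gρ => (hfix gρ).1) hc.finrank₂,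
    isAdmissible_map_σ₃ hg₃ hc.slice₃ (fun gρ => (hfix gρ).2) hc.finrank₃,
    hc.testI₂.trans (finrank_testI_le_relabel f₂_bijective.2 g₂_bijective.2 E₂),
    hc.testK₂.trans (finrank_testK_le_relabel f₂_bijective.2 g₂_bijective.2 E₂),
    hc.testI₃.trans (finrank_testI_le_relabel f₃_bijective.2 g₃_bijective.2 E₃),
    hc.testK₃.trans (finrank_testK_le_relabel f₃_bijective.2 g₃_bijective.2 E₃)⟩

end Field

end MatMul3

end BorderApolarity

end Literature.Computability.AlgebraicComplexity

end
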